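import Summits.CriticalPhenomena.SAWScalingLimit.Theses.SAWReversalUpgrade
import Summits.CriticalPhenomena.SAWScalingLimit.Theorems.SubseqIdentification.Negative.ProbabilityRedundant
import Summits.CriticalPhenomena.SAWScalingLimit.Theorems.ObservableToSLE.Negative.EndpointNecessity
import Literature.Probability.RandomPlanarGeometry.SAWScalingLimitFamily

/-!
# Load-bearing hypothesis of crux `SAWReversalUpgrade.NoDeepReturn` (stmt-CriticalPhenomena-18004)

Refuter (crux attack at birth), hypothesis mutation. The crux
`Summit.CriticalPhenomena.SAWScalingLimit.Theses.SAWReversalUpgrade.NoDeepReturn` says: for every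
Dobrushin domain `(D; a, b)` and every endpoint approximation `a_δ → a = D.pt 0`, `b_δ → b = D.pt 1`
(`SAW.IsEndpointApprox D a b`), for all `ε, η > 0` there is `r > 0` such that for all small `δ` the
critical SAW law gives mass `≤ η` to the walks that are `ε`-far from `a` at some time and `r`-close to
`a` at a later time.

Negative lemma (any proof must use the endpoint LIMITS of `IsEndpointApprox`, not only its
`reachable` field): if the two limit clauses are dropped (keeping eventual reachability), the
statement is FALSE. Witness, for ANY Dobrushin domain `D`: an endpoint approximation `(A, B)` of the
SWAPPED domain `D.swap = (D; b, a)` (it exists, `SAW.exists_isEndpointApprox`), read as data for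
`(D; a, b)` — the walk then starts near `b` (distance `→ dist b a ≥ 2ε` from `a`, `ε := dist b a / 2`)
and ENDS near `a` (distance `→ 0 ≤ r`), so the "deep return" event is the whole space and has law `1`
for all small `δ` (the laws are eventually probability measures), contradicting `≤ ofReal (1/2)`.
In particular the hypothesis-free version of the crux is false. The crux itself is untouched (its
`tendsto_fst : δ·a_δ → D.pt 0` excludes the witness).
-/

noncomputable section

open Literature.Probability.RandomPlanarGeometry Literature.Probability.RandomPlanarGeometry.SAW
  Literature.Probability.LatticeModels MeasureTheory Filter Topology Set
open scoped NNReal ENNReal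

namespace Summit.CriticalPhenomena.SAWScalingLimit.Theorems.NoDeepReturn.Negative

/-- **The endpoint limits are load-bearing in `SAWReversalUpgrade.NoDeepReturn`; eventual
reachability alone is not enough.** Witness in every Dobrushin domain `D`: an endpoint approximation
`(A, B)` of the swapped domain `(D; b, a)` used for `(D; a, b)`; the walk starts near `b` and ends near
`a = D.pt 0`, so `(s, t) = (0, 1)` realises the deep-return event for EVERY walk once `δ` is small,
and the event has law `1 > 1/2`. [folklore] -/
theorem sawReversalUpgrade_noDeepReturn_false_without_endpointLimits :
    ¬ (∀ (D : DobrushinDomain) (a b : ℝ → Site 2),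
      (∀ᶠ δ in 𝓝[>] (0 : ℝ), (discreteDomainGraph D.carrier δ).Reachable (a δ) (b δ)) →
      ∀ ε : ℝ, 0 < ε → ∀ η : ℝ, 0 < η → ∃ r : ℝ, 0 < r ∧
        ∀ᶠ δ in 𝓝[>] (0 : ℝ), law D.carrier δ (a δ) (b δ)
          {γ | ∃ s t : unitInterval, s < t ∧
            ε ≤ dist (γ.walk.toCurve (meshPoint δ) s) (D.pt 0) ∧
            dist (γ.walk.toCurve (meshPoint δ) t) (D.pt 0) ≤ r} ≤ ENNReal.ofReal η) := by
  intro h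
  obtain ⟨D⟩ := (inferInstance : Nonempty DobrushinDomain)
  obtain ⟨A, B, hAB⟩ := exists_isEndpointApprox D.swap
  have hne : D.pt 1 ≠ D.pt 0 := fun h' => absurd (D.pt_injective h') (by decide)
  have hd : 0 < dist (D.pt 1) (D.pt 0) := dist_pos.2 hne
  have hreach : ∀ᶠ δ in 𝓝[>] (0 : ℝ), (discreteDomainGraph D.carrier δ).Reachable (A δ) (B δ) :=
    hAB.reachable
  obtain ⟨r, hr, hev⟩ :=
    h D A B hreach (dist (D.pt 1) (D.pt 0) / 2) (half_pos hd) (1 / 2) (by norm_num)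
  -- the laws are eventually probability measures
  have h1 : ∀ᶠ δ in 𝓝[>] (0 : ℝ), IsProbabilityMeasure (law D.swap.carrier δ (A δ) (B δ)) :=
    Summit.CriticalPhenomena.SAWScalingLimit.Theorems.SubseqIdentification.Negative.eventually_isProbabilityMeasure_law
      hAB
  -- the end point `δ · B δ → a = D.pt 0` is eventually `r`-close to `a`
  have h2 : ∀ᶠ δ in 𝓝[>] (0 : ℝ), dist (meshPoint δ (B δ)) (D.pt 0) ≤ r := by
    have hB := hAB.tendsto_snd
    rw [MarkedDomain.pt_swap_one] at hB
    exact (Metric.tendsto_nhds.1 hB r hr).mono fun δ hδ => hδ.le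
  -- the starting point `δ · A δ → b = D.pt 1` is eventually `ε`-far from `a`
  have h3 : ∀ᶠ δ in 𝓝[>] (0 : ℝ),
      dist (D.pt 1) (D.pt 0) / 2 ≤ dist (meshPoint δ (A δ)) (D.pt 0) := by
    have hA := hAB.tendsto_fst
    rw [MarkedDomain.pt_swap_zero] at hA
    filter_upwards [Metric.tendsto_nhds.1 hA _ (half_pos hd)] with δ hδ
    have htri := dist_triangle (D.pt 1) (meshPoint δ (A δ)) (D.pt 0)
    rw [dist_comm] at hδ
    linarith
  obtain ⟨δ, hδev, hP, hB, hA⟩ := (hev.and (h1.and (h2.and h3))).exists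
  haveI : IsProbabilityMeasure (law D.carrier δ (A δ) (B δ)) := hP
  have h01 : (0 : unitInterval) < 1 := by
    rw [← Subtype.coe_lt_coe]
    norm_num
  -- the deep-return event is everything
  have key : law D.carrier δ (A δ) (B δ) Set.univ ≤ ENNReal.ofReal (1 / 2) := by
    refine le_trans (measure_mono fun γ _ => ?_) hδev
    refine ⟨0, 1, h01, ?_, ?_⟩
    · rw [SimpleGraph.Walk.toCurve_apply_zero]
      exact hA
    · rw [Summit.CriticalPhenomena.SAWScalingLimit.Theorems.ObservableToSLE.Negative.walk_toCurve_apply_one]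
      exact hB
  rw [measure_univ] at key
  have hlt : ENNReal.ofReal (1 / 2 : ℝ) < 1 := by
    rw [← ENNReal.ofReal_one]
    exact (ENNReal.ofReal_lt_ofReal_iff zero_lt_one).2 (by norm_num)
  exact absurd key (not_le.2 hlt)

/-- **`SAW.IsEndpointApprox` is load-bearing in `SAWReversalUpgrade.NoDeepReturn`**: the
hypothesis-free version of the crux is false (immediate from the previous theorem). [folklore] -/
theorem sawReversalUpgrade_noDeepReturn_false_without_endpointApprox :
    ¬ (∀ (D : DobrushinDomain) (a b : ℝ → Site 2),
      ∀ ε : ℝ, 0 < ε → ∀ η : ℝ, 0 < η → ∃ r : ℝ, 0 < r ∧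
        ∀ᶠ δ in 𝓝[>] (0 : ℝ), law D.carrier δ (a δ) (b δ)
          {γ | ∃ s t : unitInterval, s < t ∧
            ε ≤ dist (γ.walk.toCurve (meshPoint δ) s) (D.pt 0) ∧
            dist (γ.walk.toCurve (meshPoint δ) t) (D.pt 0) ≤ r} ≤ ENNReal.ofReal η) :=
  fun h => sawReversalUpgrade_noDeepReturn_false_without_endpointLimits
    fun D a b _ => h D a b

end Summit.CriticalPhenomena.SAWScalingLimit.Theorems.NoDeepReturn.Negative

end
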